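import Summits.CriticalPhenomena.PercolationContinuityZ3.Theorems.PercNearOneGluingNoHeavyLowerTailKnQuestion8AntitheticApex
import HarnessLib

/-!
# `NoHeavyLowerTail` (crux stmt-CriticalPhenomena-4575), antithetic vdBHK programme: DESCENT of antipodal Kleitman along uniform equivariant
# monotone maps (tool T21) — the formal reason why non-AK structures LIFT along leaf extensions and products

Support file (seat `prim-ineq-gen-7` gen 46; `--supports stmt-CriticalPhenomena-4575`).  No `sorry`, no definitions.
Memo: run/shared/lean/prim/prim-ineq-gen-7/FINDING-OBSTRUCTION-g46.md §1.

SETTING.  `X`, `Y` partial orders with involutions `ιX`, `ιY`; `π : Y → X` monotone, equivariant (`π ∘ ιY = ιX ∘ π`), `Y` finite, and all fibres of `π`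
of the same cardinality `k > 0`.  Antipodal Kleitman (AK) in the up-set form of `AntitheticApex`: `#(V ∩ ι W) ≤ #(V ∩ W)` for all up-sets `V, W`.
* `AntitheticDescent.card_preimage_const_fibre` — `#π⁻¹(S) = k · #S`.
* `AntitheticDescent.ak_of_cover` — **T21**: AK of `Y` implies AK of `X`.  (Pull the two up-sets back along `π`; the pull-backs are up-sets, `π⁻¹` commutes
  with `ι` by equivariance, and both sides of the AK inequality get multiplied by `k`.)
* `AntitheticDescent.ak_of_two_layer` — the two-layer special case used throughout the programme (`Y = X × {0,1}` with any cross conditions satisfied by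
  the 'constant' pairs `(V,V)`): if the two-layer AK inequality holds for all admissible pairs then `X` itself is AK.
* `AntitheticDescent.ak_of_prod` — AK of a product `X × Z` (componentwise order, involution `ιX × ιZ`, `Z` finite nonempty) implies AK of `X`.
MEANING (memo §1): for a finite poset `P` and a maximal element `z`, forgetting the colour of `z` is a monotone, complement-equivariant, 2-to-1 map
`Ω_P → Ω_{P∖z}` of colouring posets (labels of the other elements do not depend on `z`); likewise `Ω_{P ⊔ Q} = Ω_P × Ω_Q → Ω_P`.  Hence (contrapositive of
T21) a poset whose colouring poset is NOT antipodal Kleitman stays so after adding maximal elements or disjoint components: the NON-AK posets form an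
up-set for 'add a maximal element', and the classification of AK poset antimatroids is the list of MINIMAL non-AK posets (every proper down-subposet AK) —
the 6-crown of g45 (CROWN-counterexample.md) is the first one.  The same map exists for a pendant non-sink edge of a rooted graph (RAA order), so a minimal
counterexample to CONJECTURE RAA has no pendant edges.
-/

namespace Summit.CriticalPhenomena.PercolationContinuityZ3.Theorems

open Finset

namespace AntitheticDescent

variable {X Y : Type*} [DecidableEq X] [DecidableEq Y] [Fintype Y]

omit [DecidableEq Y] in
/-- A map with all fibres of cardinality `k` pulls a finite set `S` back to a set of cardinality `k · #S`. [this work] -/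
theorem card_preimage_const_fibre (π : Y → X) (k : ℕ)
    (hfib : ∀ x, (Finset.univ.filter (fun y => π y = x)).card = k) (S : Finset X) :
    (Finset.univ.filter (fun y => π y ∈ S)).card = k * S.card := by
  have hmaps : Set.MapsTo π ↑(Finset.univ.filter (fun y => π y ∈ S)) ↑S := by
    intro y hy
    exact Finset.mem_coe.2 (Finset.mem_filter.1 (Finset.mem_coe.1 hy)).2
  rw [Finset.card_eq_sum_card_fiberwise hmaps]
  have hx : ∀ x ∈ S, ((Finset.univ.filter (fun y => π y ∈ S)).filter (fun y => π y = x)).card = k := by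
    intro x hx
    rw [← hfib x]
    congr 1
    ext y
    simp only [Finset.mem_filter, Finset.mem_univ, true_and]
    constructor
    · rintro ⟨_, h⟩
      exact h
    · intro h
      exact ⟨h ▸ hx, h⟩
  rw [Finset.sum_congr rfl hx, Finset.sum_const, smul_eq_mul, mul_comm]

variable [PartialOrder X] [PartialOrder Y]

/-- **DESCENT (T21).**  Let `π : Y → X` be monotone and equivariant for involutions `ιY`, `ιX`, with all fibres of the same cardinality `k > 0`
(`Y` finite).  If `Y` is antipodal Kleitman in up-set form, so is `X`. [this work] -/
theorem ak_of_cover (ιX : X → X) (ιY : Y → Y) (hιX : Function.Involutive ιX) (hιY : Function.Involutive ιY)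
    (π : Y → X) (hmono : ∀ a b : Y, a ≤ b → π a ≤ π b) (heq : ∀ y, π (ιY y) = ιX (π y))
    (k : ℕ) (hk : 0 < k) (hfib : ∀ x, (Finset.univ.filter (fun y => π y = x)).card = k)
    (hAKY : ∀ V W : Finset Y, (∀ a b, a ≤ b → a ∈ V → b ∈ V) → (∀ a b, a ≤ b → a ∈ W → b ∈ W) →
      (V ∩ W.image ιY).card ≤ (V ∩ W).card)
    (V W : Finset X) (hV : ∀ a b, a ≤ b → a ∈ V → b ∈ V) (hW : ∀ a b, a ≤ b → a ∈ W → b ∈ W) :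
    (V ∩ W.image ιX).card ≤ (V ∩ W).card := by
  classical
  set V' : Finset Y := Finset.univ.filter (fun y => π y ∈ V) with hV'
  set W' : Finset Y := Finset.univ.filter (fun y => π y ∈ W) with hW'
  have hV'up : ∀ a b, a ≤ b → a ∈ V' → b ∈ V' := by
    intro a b hab ha
    simp only [hV', Finset.mem_filter, Finset.mem_univ, true_and] at ha ⊢
    exact hV _ _ (hmono a b hab) ha
  have hW'up : ∀ a b, a ≤ b → a ∈ W' → b ∈ W' := by
    intro a b hab ha
    simp only [hW', Finset.mem_filter, Finset.mem_univ, true_and] at ha ⊢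
    exact hW _ _ (hmono a b hab) ha
  have h := hAKY V' W' hV'up hW'up
  have e1 : V' ∩ W' = Finset.univ.filter (fun y => π y ∈ V ∩ W) := by
    ext y
    simp only [hV', hW', Finset.mem_inter, Finset.mem_filter, Finset.mem_univ, true_and]
  have e2 : V' ∩ W'.image ιY = Finset.univ.filter (fun y => π y ∈ V ∩ W.image ιX) := by
    ext y
    rw [Finset.mem_inter, AntitheticApex.mem_image_invol ιY hιY]
    simp only [hV', hW', Finset.mem_inter, Finset.mem_filter, Finset.mem_univ, true_and]
    rw [AntitheticApex.mem_image_invol ιX hιX, heq y]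
  rw [e1, e2, card_preimage_const_fibre π k hfib, card_preimage_const_fibre π k hfib] at h
  exact Nat.le_of_mul_le_mul_left h hk

omit [DecidableEq Y] [Fintype Y] [PartialOrder Y] in
/-- Two-layer special case: if the two-layer AK inequality `#(U₀ ∩ ιW₁) + #(U₁ ∩ ιW₀) ≤ #(U₀ ∩ W₀) + #(U₁ ∩ W₁)` holds for all pairs of up-sets of `X`
subject to cross conditions `C` that every constant pair `(V,V)` satisfies (as for every twisted double / crossing-rung extension of the programme), then
`X` is antipodal Kleitman. [this work] -/
theorem ak_of_two_layer (ι : X → X) (C : Finset X → Finset X → Prop) (hC : ∀ V : Finset X, (∀ a b, a ≤ b → a ∈ V → b ∈ V) → C V V)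
    (h2 : ∀ U₀ U₁ W₀ W₁ : Finset X,
      (∀ a b, a ≤ b → a ∈ U₀ → b ∈ U₀) → (∀ a b, a ≤ b → a ∈ U₁ → b ∈ U₁) →
      (∀ a b, a ≤ b → a ∈ W₀ → b ∈ W₀) → (∀ a b, a ≤ b → a ∈ W₁ → b ∈ W₁) → C U₀ U₁ → C W₀ W₁ →
      (U₀ ∩ W₁.image ι).card + (U₁ ∩ W₀.image ι).card ≤ (U₀ ∩ W₀).card + (U₁ ∩ W₁).card)
    (V W : Finset X) (hV : ∀ a b, a ≤ b → a ∈ V → b ∈ V) (hW : ∀ a b, a ≤ b → a ∈ W → b ∈ W) :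
    (V ∩ W.image ι).card ≤ (V ∩ W).card := by
  have h := h2 V V W W hV hV hW hW (hC V hV) (hC W hW)
  omega

/-- Products: if `X × Z` (componentwise order, involution `(x,z) ↦ (ιX x, ιZ z)`, `Z` finite and nonempty) is antipodal Kleitman, so is `X`.
(The converse direction — AK is closed under products — is `AntitheticProduct` of g17.) [this work] -/
theorem ak_of_prod {Z : Type*} [DecidableEq Z] [Fintype Z] [PartialOrder Z] [Fintype X] [Nonempty Z]
    (ιX : X → X) (ιZ : Z → Z) (hιX : Function.Involutive ιX) (hιZ : Function.Involutive ιZ)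
    (hAK : ∀ V W : Finset (X × Z), (∀ a b, a ≤ b → a ∈ V → b ∈ V) → (∀ a b, a ≤ b → a ∈ W → b ∈ W) →
      (V ∩ W.image (fun p => (ιX p.1, ιZ p.2))).card ≤ (V ∩ W).card)
    (V W : Finset X) (hV : ∀ a b, a ≤ b → a ∈ V → b ∈ V) (hW : ∀ a b, a ≤ b → a ∈ W → b ∈ W) :
    (V ∩ W.image ιX).card ≤ (V ∩ W).card := by
  classical
  have hιι : Function.Involutive (fun p : X × Z => (ιX p.1, ιZ p.2)) := by
    intro p
    simp only [hιX p.1, hιZ p.2]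
  refine ak_of_cover ιX (fun p : X × Z => (ιX p.1, ιZ p.2)) hιX hιι Prod.fst (fun a b hab => (Prod.le_def.1 hab).1) (fun _ => rfl)
    (Fintype.card Z) Fintype.card_pos ?_ hAK V W hV hW
  intro x
  rw [← Fintype.card_subtype]
  refine Fintype.card_congr ?_
  exact
    { toFun := fun p => p.1.2
      invFun := fun z => ⟨(x, z), rfl⟩
      left_inv := by
        rintro ⟨⟨a, b⟩, hp⟩
        change a = x at hp
        subst hp
        rfl
      right_inv := fun z => rfl }

end AntitheticDescent

end Summit.CriticalPhenomena.PercolationContinuityZ3.Theorems
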